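/-
PORT (pub-hodgecm2, COR-CM cell) of the stage-1 package file `HodgeCMPerL/HodgeCM/Proofs/Pohlmann/Descent.lean`
(pub-hodgecm HOME/lean, bytes of record md5 055b199509a1, 191 lines). Declarations VERBATIM; edits: imports rewritten to tree
modules, namespace token `HodgeCM` ↦ `Summit.HodgeConjecture.CorCM`, package `conjRingHomK` ↦ tree `Literature.NumberTheory.Automorphic.cmConjRingHom`
(definitionally equal bodies), linter fixes. Generator: pub-hodgecm2-p1 `work/port/build_kit.py`.
-/
import Mathlib.LinearAlgebra.Charpoly.BaseChange
import Mathlib.LinearAlgebra.Eigenspace.Charpoly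
import Mathlib.LinearAlgebra.Eigenspace.Triangularizable
import Mathlib.RingTheory.Flat.Basic
import Literature.AlgebraicGeometry.Motives.HodgeStructure

/-!
# Pohlmann's span theorem, I: three pieces of linear algebra

Pure linear algebra used by the proof of `Summit.HodgeConjecture.CorCM.Universe.PohlmannSpan`
(`Summit.HodgeConjecture.CorCM/Proofs/PohlmannSpan.lean`); nothing here mentions the geometric universe.

* `le_biSup_of_iSupIndep_of_iSup_eq_top` and its corollaries `eq_of_iSupIndep_of_iSup_eq_top`,
  `exists_of_iSupIndep_of_ne_bot`: if an INDEPENDENT family `t` dominates termwise (`w k ≤ t (g k)`) a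
  family `w` that already spans everything, then `t i` is the join of the `w k` with `g k = i` — so the
  eigenspaces of an operator acting by pairwise distinct scalars on a spanning family of subspaces ARE those
  subspaces (used with `Module.End.eigenspaces_iSupIndep`).
* `exists_eigenvector_mem_baseChange_iff`: for a `K`-linear `T : V → V`, a `T`-stable `K`-subspace `B` and a
  field extension `L/K`, the base change `T_L` has an eigenvector with eigenvalue `μ ∈ L` INSIDE `B_L ⊆ V_L`
  iff `μ` is a root of the (rational!) characteristic polynomial of `T|_B` — the rationality statement that
  replaces the action of `Aut(ℂ/ℚ)` on coefficients in Pohlmann's argument (Gao–Ullmo, J. Inst. Math.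
  Jussieu 25 (2025) 215–249 = arXiv:2411.12249, proof of Thm 3.1, p. 9: "for each `τ ∈ Aut(ℂ/ℚ)` we then
  have `Σ τ(c_j)[τP_j] = τ(f) = f`").  Mathlib: `LinearMap.charpoly_baseChange`,
  `Module.End.hasEigenvalue_iff_isRoot_charpoly`, flatness of `L/K`.
* `piece_inf_piece_eq_bot`: distinct Hodge pieces `V^{a,b}`, `V^{p,q}` of a pure Hodge structure meet in `0`
  (Deligne, *Théorie de Hodge II*, 1.2.5: `F` and `conj F` are `n`-opposed), from the two axioms
  `antitone_F` and `isCompl_F_complexConj` of the vendored `HodgeStructure`.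
-/

noncomputable section

open scoped TensorProduct

namespace Summit.HodgeConjecture.CorCM.Pohlmann

/-! ### An independent family dominating a spanning family -/

section Lattice

variable {R W : Type*} [Ring R] [AddCommGroup W] [Module R W] {ι κ : Type*}

/-- If `t` is independent, `w k ≤ t (g k)` for all `k`, and `⨆ w = ⊤`, then `t i ≤ ⨆_{g k = i} w k`. -/
theorem le_biSup_of_iSupIndep_of_iSup_eq_top {t : ι → Submodule R W} (ht : iSupIndep t)
    {w : κ → Submodule R W} (g : κ → ι) (hw : ∀ k, w k ≤ t (g k)) (htop : ⨆ k, w k = ⊤) (i : ι) :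
    t i ≤ ⨆ (k) (_ : g k = i), w k := by
  intro x hx
  have hx' : x ∈ ⨆ k, w k := by rw [htop]; exact Submodule.mem_top
  rw [iSup_split w (fun k => g k = i)] at hx'
  obtain ⟨y, hy, z, hz, rfl⟩ := Submodule.mem_sup.1 hx'
  have h1 : (⨆ (k) (_ : g k = i), w k) ≤ t i := iSup₂_le fun k hk => hk ▸ hw k
  have h2 : (⨆ (k) (_ : ¬ g k = i), w k) ≤ ⨆ (j) (_ : j ≠ i), t j :=
    iSup₂_le fun k hk => (hw k).trans (le_iSup₂_of_le (g k) hk le_rfl)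
  have hyt : y ∈ t i := h1 hy
  have hzt : z ∈ t i := by simpa using (t i).sub_mem hx hyt
  have hz' : z ∈ ⨆ (j) (_ : j ≠ i), t j := h2 hz
  have hz0 : z = 0 := (Submodule.disjoint_def.1 (ht i)) z hzt hz'
  rw [hz0, add_zero]
  exact hy

/-- With `g` injective, the dominating independent family coincides with the spanning one on the range
of `g`: `t (g k) = w k`. -/
theorem eq_of_iSupIndep_of_iSup_eq_top {t : ι → Submodule R W} (ht : iSupIndep t)
    {w : κ → Submodule R W} {g : κ → ι} (hg : Function.Injective g) (hw : ∀ k, w k ≤ t (g k))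
    (htop : ⨆ k, w k = ⊤) (k : κ) : t (g k) = w k := by
  refine le_antisymm ?_ (hw k)
  refine (le_biSup_of_iSupIndep_of_iSup_eq_top ht g hw htop (g k)).trans (iSup₂_le fun k' hk' => ?_)
  rw [hg hk']

/-- Off the range of `g` the dominating independent family vanishes: `t i ≠ ⊥ → i ∈ range g`. -/
theorem exists_of_iSupIndep_of_ne_bot {t : ι → Submodule R W} (ht : iSupIndep t)
    {w : κ → Submodule R W} (g : κ → ι) (hw : ∀ k, w k ≤ t (g k)) (htop : ⨆ k, w k = ⊤) {i : ι}
    (hi : t i ≠ ⊥) : ∃ k, g k = i := by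
  by_contra h
  apply hi
  rw [eq_bot_iff]
  refine (le_biSup_of_iSupIndep_of_iSup_eq_top ht g hw htop i).trans (iSup₂_le fun k hk => ?_)
  exact absurd ⟨k, hk⟩ h

end Lattice

/-! ### Eigenvectors inside the base change of an invariant rational subspace -/

section BaseChange

variable {K L V : Type*} [Field K] [Field L] [Algebra K L] [AddCommGroup V] [Module K V]
  [FiniteDimensional K V]

omit [FiniteDimensional K V] in
/-- The base change of the inclusion of a subspace is injective (a field extension is flat). -/
theorem baseChange_subtype_injective (B : Submodule K V) :
    Function.Injective ((B.subtype).baseChange L) := by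
  rw [LinearMap.baseChange_eq_ltensor]
  exact Module.Flat.lTensor_preserves_injective_linearMap _ B.injective_subtype

omit [FiniteDimensional K V] in
/-- `T_L ∘ ι_L = ι_L ∘ (T|_B)_L` for the inclusion `ι : B ↪ V` of a `T`-stable subspace. -/
theorem baseChange_apply_subtype_baseChange (T : V →ₗ[K] V) {B : Submodule K V}
    (hB : ∀ v ∈ B, T v ∈ B) (y : L ⊗[K] B) :
    T.baseChange L ((B.subtype).baseChange L y) =
      (B.subtype).baseChange L ((T.restrict hB).baseChange L y) := by
  have h : T ∘ₗ B.subtype = B.subtype ∘ₗ T.restrict hB := by ext v; rfl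
  rw [← LinearMap.comp_apply, ← LinearMap.baseChange_comp, h, LinearMap.baseChange_comp,
    LinearMap.comp_apply]

/-- **Rationality of the eigenvalues met by a rational subspace.**  For a `K`-linear endomorphism `T`
of a finite-dimensional `K`-space `V`, a `T`-stable subspace `B` and a field extension `L`, the base
change `T_L` has an eigenvector of eigenvalue `μ` lying in `B_L = L ⊗ B ⊆ L ⊗ V` if and only if `μ` is
a root of the characteristic polynomial of `T|_B` (a polynomial over `K`). -/
theorem exists_eigenvector_mem_baseChange_iff (T : V →ₗ[K] V) {B : Submodule K V}
    (hB : ∀ v ∈ B, T v ∈ B) (μ : L) :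
    (∃ x ∈ B.baseChange L, x ≠ 0 ∧ T.baseChange L x = μ • x) ↔
      ((T.restrict hB).charpoly.map (algebraMap K L)).IsRoot μ := by
  rw [← LinearMap.charpoly_baseChange, ← Module.End.hasEigenvalue_iff_isRoot_charpoly]
  have inj := baseChange_subtype_injective (L := L) B
  constructor
  · rintro ⟨x, hx, hx0, hTx⟩
    obtain ⟨y, rfl⟩ : ∃ y, (B.subtype).baseChange L y = x := hx
    have hy : (T.restrict hB).baseChange L y = μ • y := by
      apply inj
      rw [← baseChange_apply_subtype_baseChange, hTx, map_smul]
    have hy0 : y ≠ 0 := by rintro rfl; exact hx0 (map_zero _)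
    exact Module.End.hasEigenvalue_of_hasEigenvector
      (Module.End.hasEigenvector_iff.2 ⟨Module.End.mem_eigenspace_iff.2 hy, hy0⟩)
  · intro hμ
    obtain ⟨y, hy⟩ := hμ.exists_hasEigenvector
    refine ⟨(B.subtype).baseChange L y, ⟨y, rfl⟩, (map_ne_zero_iff _ inj).2 hy.2, ?_⟩
    rw [baseChange_apply_subtype_baseChange T hB, hy.apply_eq_smul, map_smul]

omit [FiniteDimensional K V] in
/-- The base change `B_L` of a `T`-stable subspace is `T_L`-stable. -/
theorem baseChange_mem_baseChange_of_mem (T : V →ₗ[K] V) {B : Submodule K V}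
    (hB : ∀ v ∈ B, T v ∈ B) {x : L ⊗[K] V} (hx : x ∈ B.baseChange L) :
    T.baseChange L x ∈ B.baseChange L := by
  obtain ⟨y, rfl⟩ : ∃ y, (B.subtype).baseChange L y = x := hx
  rw [baseChange_apply_subtype_baseChange T hB]
  exact ⟨_, rfl⟩

end BaseChange

/-! ### Distinct Hodge pieces are disjoint -/

section Hodge

open Literature.AlgebraicGeometry.Motives
open Literature.AlgebraicGeometry.Motives.HodgeStructure

variable {V : Type*} [AddCommGroup V] [Module ℚ V] {n : ℤ}

/-- Distinct Hodge pieces meet trivially: `V^{a,b} ∩ V^{p,q} = 0` for `(a,b) ≠ (p,q)`, `p + q = n`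
(Deligne, *Théorie de Hodge II*, 1.2.5; here from `F^{a+1} ∩ conj F^{b} = 0` for `a + b = n`). -/
theorem piece_inf_piece_eq_bot (H : HodgeStructure V n) {a b p q : ℤ} (hpq : p + q = n)
    (hne : (a, b) ≠ (p, q)) : H.piece a b ⊓ H.piece p q = ⊥ := by
  by_cases hab : a + b = n
  swap
  · rw [piece_eq_bot_of_add_ne H hab, bot_inf_eq]
  have hap : a ≠ p := by
    rintro rfl
    exact hne (by rw [show b = q by omega])
  rcases lt_or_gt_of_ne hap with h | h
  · -- `a < p`: `V^{p,q} ⊆ F^p ⊆ F^{a+1}` and `V^{a,b} ⊆ conj F^b`, complementary pieces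
    have hF : H.F p ≤ H.F (a + 1) := H.antitone_F (show a + 1 ≤ p by omega)
    have hd : Disjoint (H.F (a + 1)) (complexConj (H.F b)) :=
      (H.isCompl_F_complexConj (a + 1) b (by omega)).disjoint
    exact (hd.symm.mono (piece_le_complexConj_F H a b) ((piece_le_F H p q).trans hF)).eq_bot
  · -- `p < a`: symmetric
    have hF : H.F a ≤ H.F (p + 1) := H.antitone_F (show p + 1 ≤ a by omega)
    have hd : Disjoint (H.F (p + 1)) (complexConj (H.F q)) :=
      (H.isCompl_F_complexConj (p + 1) q (by omega)).disjoint
    exact (hd.mono ((piece_le_F H a b).trans hF) (piece_le_complexConj_F H p q)).eq_bot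

/-- The complexification `B ⊗ ℂ` of the rational Hodge classes `B = V ∩ V^{p,p}` (weight `n = 2p`) lies
in `V^{p,p}`. -/
theorem baseChange_hodgeClasses_le_piece (H : HodgeStructure V n) {p : ℤ} (hn : p + p = n) :
    (H.hodgeClasses p).baseChange ℂ ≤ H.piece p p := by
  rw [Submodule.baseChange_eq_span, Submodule.span_le]
  rintro _ ⟨v, hv, rfl⟩
  exact ofRat_mem_piece_of_mem_hodgeClasses H hn hv

end Hodge

end Summit.HodgeConjecture.CorCM.Pohlmann

end
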